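import Summits.BirchSwinnertonDyer.BirchSwinnertonDyer.Theorems.GenusKolyvaginAtTwoShaCardDvdPowAtTwoRTPairSandwichSignFree
import Summits.BirchSwinnertonDyer.BirchSwinnertonDyer.Theorems.GenusKolyvaginAtTwoShaCardDvdPowAtTwoRTTwistTransportSha
import Literature.NumberTheory.EllipticCurves.QuadraticTwistLocalPolynomialTwoProofs
import Literature.NumberTheory.EllipticCurves.TwistFamilySelmerGroupCardInvarianceProofs
import Literature.NumberTheory.EllipticCurves.SelmerTrivialCorankProofs
import Literature.NumberTheory.EllipticCurves.SelmerGroupCardinality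
import Literature.NumberTheory.EllipticCurves.KolyvaginShaStructureIndexFormProofs
import Literature.NumberTheory.DiophantineGeometry.LocalReductionProofs
import HarnessLib

/-!
# Route `GenusKolyvaginAtTwo`, crux U₂ `MinimalTwinBSDTwo` (stmt-BirchSwinnertonDyer-22985), LINE 23 «twin_swap» (pen bsd-idea-1 g23),
# stub S3 `SwappedPairDescentAtTwo` on its method slice — FRAME LEMMAS OF THE SWAPPED PAIR SANDWICH

Seat `bsd-line-gk2-p2` g23 (PROVER seat 2/3, cell `bsd-f1-sign2`), `--supports stmt-BirchSwinnertonDyer-22985` (helper; closes nothing).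
THEOREMS ONLY (no definition, no named fact, no `sorry`); standard axioms.  **BSD is NOT proved by this file; U₂ / hTw is NOT proved;
no item is closed.**

THE SWAP (LINE 23, pen card `twin_swap.md` v1.1 on crux 22985).  The rank-one `2`-Selmer-minimal curve `E` (odd Tamagawa product) is the
Heegner-carrying member (`ε = −1`) of a pair `(E, E^(d_K))` whose twin has rank `0` and `#Sel₂ = 1`.  The sequel file
`…MinimalTwinBSDTwoSwappedPairSandwich` proves `Ш(E/K)[2^∞] = 0` on that frame inside the genus budget by reading gk2-p3 g27's sign-free pair
sandwich with the `2`-Selmer-TRIVIAL twin as base.  This file supplies its frame lemmas, stated GENERICALLY (any field / number field `F`)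
so that, read over `ℚ`, the group law on `E(ℚ)` carries one `DecidableEq ℚ` instance throughout:

* §1 `finite_and_natCard_primaryComponent_eq_of_addEquiv` — an additive isomorphism carrying a subgroup onto a subgroup identifies their
  `p`-primary components (used with the `Ш`-level twist transport `Ψ`, gk2-p4 g22 `exists_galH1_twistTransport`).
* §2 `exists_antiInvariant_twist_point_of_not_isOfFinAddOrder` — **the anti-invariant frame point of the twist**: for `V/F`, `K = F(θ)`,
  `θ² = c`, `σθ = −θ` and `P ∈ V(F)` of infinite order, the twisting map (Silverman X.5.4 / Exercise 10.16, `QuadraticDescent.twistMap`, through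
  `(V^(c))^(c) = D • V`) gives `y ∈ V^(c)(K)` of infinite order with `σy = −y`;
  `rank_eq_one_and_sha_primary_eq_zero_of_natCard_selmerGroup_eq_two` — `#Sel₂ = 2` with positive rank ⟹ rank `1`, `E(F)[2] = 0`,
  `Ш(E/F)[2^∞] = 0` (descent count); `exists_not_isOfFinAddOrder_of_one_le_mordellWeilRank`.
* §3 `natCard_twoTorsion_baseChange_eq_of_smul` (local `2`-torsion counts are model-free) and `forall_two_zsmul_baseChange_eq_zero_of_heegner`
  — `E(K)[2] = 0` from `E(ℚ)[2] = 0` for a Heegner field of odd discriminant (`E(K) ⊆ E(K[1])`, tree theorem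
  `Uniform.U2.RingClass.forall_two_nsmul_eq_zero_of_heegner`).

Beyond print: no (Silverman X / Gross 1991 §5 bookkeeping).  BSD is NOT proved; nothing is closed.

References: [SilvermanAEC2009] X.4.2, X.5 Cor. 5.4, Exercise 10.16; [GrossLMS1991] §4 Lemma 4.3, §5 (5.1).
-/

set_option autoImplicit false
set_option linter.dupNamespace false -- `Summit.<P>.<Sub>` repeats `BirchSwinnertonDyer` (D-0017)

noncomputable section

open scoped Classical

namespace Summit.BirchSwinnertonDyer.BirchSwinnertonDyer.Theorems.GenusExact.TwinSwap

open Literature.NumberTheory.EllipticCurves Literature.NumberTheory.GaloisRepresentations WeierstrassCurve NumberField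
  IsDedekindDomain Field AddSubgroup
open Summit.BirchSwinnertonDyer.Rank1Residual Literature.Barriers.BirchSwinnertonDyer
open Summit.BirchSwinnertonDyer.BirchSwinnertonDyer.Theorems.GenusExact.PlusDescent
open Summit.BirchSwinnertonDyer.BirchSwinnertonDyer.Theorems.GenusExact.RegularPlusDescent (archimedeanBit_sha_comap_resBaseChange
  relIndex_sha_comap_resBaseChange_le_of_arch relIndex_sha_comap_resBaseChange_twin_le_two_pow_succ_of_arch)


/-! ## §1 Bookkeeping: primary components along an additive isomorphism -/

/-- An additive isomorphism `Ψ : A ≃+ B` with `x ∈ S ↔ Ψ x ∈ T` identifies the `p`-primary components of `S` and `T` numerically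
(and carries finiteness). [folklore] -/
theorem finite_and_natCard_primaryComponent_eq_of_addEquiv {A B : Type*} [AddCommGroup A] [AddCommGroup B] (Ψ : A ≃+ B)
    (S : AddSubgroup A) (T : AddSubgroup B) (h : ∀ x, x ∈ S ↔ Ψ x ∈ T) (p : ℕ)
    [Finite (AddCommGroup.primaryComponent (↥S) p)] :
    Finite (AddCommGroup.primaryComponent (↥T) p) ∧
      Nat.card (AddCommGroup.primaryComponent (↥T) p) = Nat.card (AddCommGroup.primaryComponent (↥S) p) := by
  -- the restriction `S ≃+ T`
  set e : ↥S ≃+ ↥T :=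
    { toFun := fun x ↦ ⟨Ψ x.1, (h x.1).mp x.2⟩
      invFun := fun y ↦ ⟨Ψ.symm y.1, by have := (h (Ψ.symm y.1)); rw [AddEquiv.apply_symm_apply] at this; exact this.mpr y.2⟩
      left_inv := fun x ↦ Subtype.ext (by simp)
      right_inv := fun y ↦ Subtype.ext (by simp)
      map_add' := fun x y ↦ Subtype.ext (by simp) } with he
  -- `e` preserves `p`-primary components
  have hmem : ∀ x : ↥S, x ∈ AddCommGroup.primaryComponent (↥S) p ↔ e x ∈ AddCommGroup.primaryComponent (↥T) p := by
    intro x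
    rw [AddCommGroup.mem_primaryComponent, AddCommGroup.mem_primaryComponent]
    refine exists_congr fun k ↦ ?_
    rw [← map_nsmul, AddEquiv.map_eq_zero_iff]
  set f : AddCommGroup.primaryComponent (↥S) p ≃ AddCommGroup.primaryComponent (↥T) p :=
    { toFun := fun x ↦ ⟨e x.1, (hmem x.1).mp x.2⟩
      invFun := fun y ↦ ⟨e.symm y.1, by have := hmem (e.symm y.1); rw [AddEquiv.apply_symm_apply] at this; exact this.mpr y.2⟩
      left_inv := fun x ↦ Subtype.ext (by simp)
      right_inv := fun y ↦ Subtype.ext (by simp) } with hf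
  exact ⟨Finite.of_equiv _ f, (Nat.card_congr f).symm⟩


/-! ## §2 Generic frame lemmas (any base field / number field — stated generically so that, read over `ℚ`, the group law on
`E(ℚ)` carries ONE `DecidableEq ℚ` instance throughout) -/

section Generic

/-- Transport along an equality of `F`-models commutes with the Galois action on `K`-points. [folklore] -/
private theorem map_congrEquiv_baseChange {F K : Type*} [Field F] [Field K] [Algebra F K] {V₁ V₂ : WeierstrassCurve F} (h : V₁ = V₂)
    (f : K →ₐ[F] K) (P : (V₁.baseChange K).toAffine.Point) :
    Affine.Point.map (W' := V₂) f (Affine.Point.congrEquiv (congrArg (fun V : WeierstrassCurve F ↦ V.baseChange K) h) P) =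
      Affine.Point.congrEquiv (congrArg (fun V : WeierstrassCurve F ↦ V.baseChange K) h) (Affine.Point.map (W' := V₁) f P) := by
  subst h
  rfl

/-- **The anti-invariant frame point of the twist from a rational point.**  `V/F`, `K = F(θ)` with `θ² = c ≠ 0`, `σ ∈ Aut(K/F)` with
`σθ = −θ`, and `P ∈ V(F)` of infinite order: the twisting map `τ : V(F) ≅ (V^(c))^(c)(F) → V^(c)(K)` (Silverman X.5.4 / Exercise 10.16,
`QuadraticDescent.twistMap`, through `(V^(c))^(c) = D • V` and `(V^(c))^(1) = V^(c)`) gives a point `y ∈ V^(c)(K)` of infinite order with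
**`σy = −y`**.  [cite: SilvermanAEC2009, X.5 Cor. 5.4 and Exercise 10.16] -/
theorem exists_antiInvariant_twist_point_of_not_isOfFinAddOrder {F K : Type*} [Field F] [Field K] [Algebra F K] [NeZero (2 : F)]
    (V : WeierstrassCurve F) {θ : K} {c : F} (hθ : θ ∉ Set.range (algebraMap F K)) (hc : θ ^ 2 = algebraMap F K c) (hc0 : c ≠ 0)
    {σ : K →ₐ[F] K} (hσ : σ θ = -θ) {P : V.toAffine.Point} (hP : ¬ IsOfFinAddOrder P) :
    ∃ y : ((V.quadraticTwist c).baseChange K).toAffine.Point,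
      ¬ IsOfFinAddOrder y ∧ Affine.Point.map (W' := V.quadraticTwist c) σ y = -y := by
  obtain ⟨D, hD⟩ := exists_quadraticTwist_quadraticTwist_eq_smul V hc0
  have e₀ : (V.quadraticTwist c).quadraticTwist 1 = V.quadraticTwist c := by rw [quadraticTwist_quadraticTwist, mul_one]
  let e₁ : V.toAffine.Point ≃+ ((V.quadraticTwist c).quadraticTwist c).toAffine.Point :=
    (VariableChange.pointEquiv V D).trans (Affine.Point.congrEquiv hD.symm)
  let y₁ := QuadraticDescent.twistMap (V.quadraticTwist c) hθ hc (e₁ P)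
  refine ⟨Affine.Point.congrEquiv (congrArg (fun X : WeierstrassCurve F ↦ X.baseChange K) e₀) y₁, fun hfin ↦ hP ?_, ?_⟩
  · have h1 : IsOfFinAddOrder y₁ :=
      (Function.Injective.isOfFinAddOrder_iff
        (f := (Affine.Point.congrEquiv (congrArg (fun X : WeierstrassCurve F ↦ X.baseChange K) e₀)).toAddMonoidHom)
        (AddEquiv.injective _)).mp hfin
    have h2 : IsOfFinAddOrder (e₁ P) :=
      (Function.Injective.isOfFinAddOrder_iff (QuadraticDescent.twistMap_injective (V.quadraticTwist c) hθ hc)).mp h1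
    exact (Function.Injective.isOfFinAddOrder_iff (f := e₁.toAddMonoidHom) e₁.injective).mp h2
  · rw [map_congrEquiv_baseChange e₀, ← map_neg]
    exact congrArg _ (QuadraticDescent.conjMap_twistMap (V.quadraticTwist c) hθ hc hσ (e₁ P))

variable {F : Type} [Field F] [NumberField F]

/-- `#Sel₂ = 2` with positive rank forces rank `1`, `E(F)[2] = 0` and `Ш[2^∞] = 0` (descent count `#Sel₂ = 2^rank · #E(F)[2] · #(Ш ⊓ H¹[2])`).
[cite: SilvermanAEC2009, Thm. X.4.2] -/
theorem rank_eq_one_and_sha_primary_eq_zero_of_natCard_selmerGroup_eq_two (X : WeierstrassCurve F) [X.IsElliptic]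
    (hSel : Nat.card (X.selmerGroup 2) = 2) (h1 : 1 ≤ X.mordellWeilRank) :
    X.mordellWeilRank = 1 ∧ (∀ P : X.toAffine.Point, 2 • P = 0 → P = 0) ∧
      ∀ x ∈ AddCommGroup.primaryComponent (↥X.sha) 2, x = 0 := by
  haveI : Fact (Nat.Prime 2) := ⟨Nat.prime_two⟩
  have hcount := card_selmerGroup_eq_pow_rank_mul X 2
  simp only [Nat.cast_ofNat] at hcount
  rw [hSel] at hcount
  -- `2 = 2^rk · a · b` with `rk ≥ 1` forces `rk = 1`, `a = b = 1`
  have hrk : X.mordellWeilRank = 1 := by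
    have hdvd : 2 ^ X.mordellWeilRank ∣ 2 := Dvd.intro _ (by rw [mul_assoc] at hcount; exact hcount.symm)
    have hle := Nat.le_of_dvd two_pos hdvd
    by_contra h
    have h4 : 4 ≤ 2 ^ X.mordellWeilRank := by
      calc 4 = 2 ^ 2 := by norm_num
        _ ≤ 2 ^ X.mordellWeilRank := Nat.pow_le_pow_right (by norm_num) (by omega)
    omega
  rw [hrk, pow_one, mul_assoc] at hcount
  have hprod := Nat.eq_of_mul_eq_mul_left (show 0 < 2 by norm_num) ((mul_one 2).trans hcount)
  have ha := Nat.eq_one_of_mul_eq_one_right hprod.symm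
  have hb : Nat.card (X.sha ⊓ AddSubgroup.torsionBy X.galH1 (2 : ℤ) : AddSubgroup X.galH1) = 1 :=
    Nat.eq_one_of_mul_eq_one_left hprod.symm
  refine ⟨hrk, ?_, ?_⟩
  · -- `E(F)[2] = 0`
    have hsubT : Subsingleton (AddSubgroup.torsionBy X.toAffine.Point 2) := (Nat.card_eq_one_iff_unique.mp ha).1
    intro P hP
    have hmem : P ∈ AddSubgroup.torsionBy X.toAffine.Point 2 := by
      rw [mem_torsionBy_iff, show (2 : ℤ) = ((2 : ℕ) : ℤ) from rfl, natCast_zsmul]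
      exact hP
    exact congrArg Subtype.val
      (Subsingleton.elim (⟨P, hmem⟩ : AddSubgroup.torsionBy X.toAffine.Point 2) ⟨0, AddSubgroup.zero_mem _⟩)
  have hsub : Subsingleton (X.sha ⊓ AddSubgroup.torsionBy X.galH1 (2 : ℤ) : AddSubgroup X.galH1) := (Nat.card_eq_one_iff_unique.mp hb).1
  intro x hx
  by_contra hx0
  obtain ⟨k, hk⟩ := (AddCommGroup.mem_primaryComponent).1 hx
  obtain ⟨e, -, he⟩ := (Nat.dvd_prime_pow Nat.prime_two).mp (addOrderOf_dvd_iff_nsmul_eq_zero.mpr hk)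
  have he1 : 1 ≤ e := by
    by_contra h
    have h0 : e = 0 := by omega
    rw [h0, pow_zero, AddMonoid.addOrderOf_eq_one_iff] at he
    exact hx0 he
  set y : X.sha := 2 ^ (e - 1) • x with hydef
  have hy2 : 2 • y = 0 := by
    rw [hydef, ← mul_nsmul', ← pow_succ', Nat.sub_add_cancel he1, ← he]
    exact addOrderOf_nsmul_eq_zero x
  have hy0 : y ≠ 0 := by
    intro h
    have hdvd : addOrderOf x ∣ 2 ^ (e - 1) := addOrderOf_dvd_iff_nsmul_eq_zero.mpr (by rw [← hydef]; exact h)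
    rw [he, Nat.pow_dvd_pow_iff_le_right (by norm_num)] at hdvd
    omega
  have hymem : ((y : X.sha) : X.galH1) ∈ (X.sha ⊓ AddSubgroup.torsionBy X.galH1 (2 : ℤ) : AddSubgroup X.galH1) := by
    refine AddSubgroup.mem_inf.mpr ⟨y.2, ?_⟩
    have h2y : (2 : ℤ) • ((y : X.sha) : X.galH1) = 0 := by
      rw [show (2 : ℤ) = ((2 : ℕ) : ℤ) from rfl, natCast_zsmul, ← AddSubgroupClass.coe_nsmul, hy2, ZeroMemClass.coe_zero]
    exact mem_torsionBy_iff.mpr h2y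
  have h0 : (⟨((y : X.sha) : X.galH1), hymem⟩ : (X.sha ⊓ AddSubgroup.torsionBy X.galH1 (2 : ℤ) : AddSubgroup X.galH1)) =
      ⟨0, AddSubgroup.zero_mem _⟩ := Subsingleton.elim _ _
  have hval : ((y : X.sha) : X.galH1) = 0 := congrArg Subtype.val h0
  exact hy0 (Subtype.ext hval)

/-- A curve of positive Mordell–Weil rank over a number field has a rational point of infinite order. [folklore] -/
theorem exists_not_isOfFinAddOrder_of_one_le_mordellWeilRank (X : WeierstrassCurve F) [X.IsElliptic]
    (h : 1 ≤ X.mordellWeilRank) : ∃ P : X.toAffine.Point, ¬ IsOfFinAddOrder P := by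
  by_contra hall
  push Not at hall
  haveI : Module.Finite ℤ X.toAffine.Point := X.module_finite_point_holds
  have hfin : Finite X.toAffine.Point := by
    haveI : AddGroup.FG X.toAffine.Point := Module.Finite.iff_addGroup_fg.mp inferInstance
    exact AddCommGroup.finite_of_fg_torsion X.toAffine.Point hall
  have h0 : X.mordellWeilRank = 0 := X.mordellWeilRank_eq_zero_iff_finite.mpr hfin
  omega

end Generic

/-! ## §3 Model-free local `2`-torsion counts; `E(K)[2] = 0` for a Heegner field -/

section Heegner

variable (W : WeierstrassCurve ℚ) [W.IsElliptic] [W.IsGloballyMinimal]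
variable (K : Type) [Field K] [NumberField K]

/-- `2`-torsion counts of `L`-points are invariant under a change of variables over `ℚ`. [folklore] -/
theorem natCard_twoTorsion_baseChange_eq_of_smul {V X : WeierstrassCurve ℚ} (D : VariableChange ℚ) (hD : X = D • V)
    (L : Type) [Field L] [Algebra ℚ L] :
    Nat.card {P : (X.baseChange L).toAffine.Point // 2 • P = 0} = Nat.card {P : (V.baseChange L).toAffine.Point // 2 • P = 0} := by
  subst hD
  let eL : (V.baseChange L).toAffine.Point ≃+ ((D • V).baseChange L).toAffine.Point := VariableChange.pointEquivBaseChange V D L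
  refine (Nat.card_congr (eL.toEquiv.subtypeEquiv fun P ↦ ?_)).symm
  change 2 • P = 0 ↔ 2 • eL P = 0
  rw [← map_nsmul, eL.map_eq_zero_iff]

/-- **`E(K)[2] = 0` from `E(ℚ)[2] = 0` for a Heegner field of odd discriminant** (`E(K) ⊆ E(K[1])` and the tree theorem
`Uniform.U2.RingClass.forall_two_nsmul_eq_zero_of_heegner`: a `2`-torsion point over a ring class field would put `Δ_E` in `d_K ℚ²`,
impossible under the Heegner hypothesis).  [cite: GrossLMS1991, §4 Lemma 4.3 (shape)] -/
theorem forall_two_zsmul_baseChange_eq_zero_of_heegner (hIQ : IsImaginaryQuadratic K) (hodd : Odd (NumberField.discr K))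
    (hHe : SatisfiesHeegnerHypothesis (W.conductorNorm ℤ) K) (hT2 : ∀ P : W.toAffine.Point, 2 • P = 0 → P = 0)
    (P : (W.baseChange K).toAffine.Point) (hP : (2 : ℤ) • P = 0) : P = 0 := by
  obtain ⟨v⟩ : Nonempty (InfinitePlace K) := inferInstance
  let ι : K →+* ℂ := v.embedding
  haveI : NumberField (ringClassField K ι 1) := numberField_ringClassField hIQ ι one_ne_zero
  have hD4 : NumberField.discr K % 4 = 1 := Literature.NumberTheory.QuadraticFields.Quadratic.discr_emod_four_eq_one hIQ.1 hodd
  set f : (W.baseChange K).toAffine.Point →+ (W.baseChange (ringClassField K ι 1)).toAffine.Point :=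
    WeierstrassCurve.Affine.Point.map (W' := W) (algebraMap K (ringClassField K ι 1)).toRatAlgHom with hf
  have hfinj : Function.Injective f :=
    WeierstrassCurve.Affine.Point.map_injective (W' := W) (algebraMap K (ringClassField K ι 1)).toRatAlgHom
  apply hfinj
  rw [map_zero]
  -- the rational `2`-torsion hypothesis in the currency of the tree theorem (two equal `DecidableEq ℚ` instances)
  have hT' : ∀ R : W.toAffine.Point, 2 • R = 0 → R = 0 := fun R hR ↦ hT2 R (by convert hR)
  refine Summit.BirchSwinnertonDyer.Uniform.U2.RingClass.forall_two_nsmul_eq_zero_of_heegner W hIQ ι hD4 hHe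
    (fun R hR ↦ by convert hT' R (by convert hR)) one_ne_zero (f P) ?_
  rw [← map_nsmul, ← natCast_zsmul, Nat.cast_ofNat, hP, map_zero]

end Heegner

end Summit.BirchSwinnertonDyer.BirchSwinnertonDyer.Theorems.GenusExact.TwinSwap

end
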